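import Mathlib
import Summits.AtomisticToContinuum.Crystallization.Theses.GappedShellCensus
import Summits.AtomisticToContinuum.Crystallization.Theses.HullMinimality
import Summits.AtomisticToContinuum.Crystallization.Theorems.PhononSlackCertificatesPeriodicGivenLayered
import Summits.AtomisticToContinuum.Crystallization.Theorems.GappedShellCensusCleanLimitsHaveWindowsReduction
import Summits.AtomisticToContinuum.Crystallization.Theorems.GappedShellCensusCleanLimitsHaveWindowsCleanChart
import Summits.AtomisticToContinuum.Crystallization.Theorems.GappedShellCensusCleanLimitsHaveWindowsCleanTornFreeBridge
import Literature.MathematicalPhysics.StatisticalMechanics.BarlowStacking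
import Literature.MathematicalPhysics.StatisticalMechanics.BarlowStackingEnergy
import Literature.MathematicalPhysics.StatisticalMechanics.HaggStacking
import Literature.MathematicalPhysics.StatisticalMechanics.LocalMatchingCompactness
import Literature.Geometry.DiscreteGeometry.KissingPatterns

/-!
# Skeleton — crux `GappedShellCensus.CleanLimitsHaveWindows` (stmt-AtomisticToContinuum-15932), line `restacked-reference`

Strategist line (planner-cstrat-stmt-AtomisticToContinuum-15932-s2-0, 2026-08-17). A RE-TYPING OF THE ENERGETIC KERNEL of the
live line `Sketch` (lead c3: `stub_cleanTornFree`, `stub_trussCoercivity`) forced by the MISFIT-MOMENT OBSTRUCTION found by this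
seat (census `STRATEGY-CENSUS-s2.md`, numerics `num/local_stack.py`, `num/words.py`):

* the planned proof of `stub_trussCoercivity` ("exact second-order expansion about the own-word, matched-spacing, free-height
  layered reference; FIRST-ORDER TERM = SURFACE ORDER by the zero-mean-stress matching") is wrong for Barlow words whose
  per-layer in-plane traction `τ_m` has a non-zero first MOMENT across the window (block words `c^k h^k`, half-crystals
  `c^∞ h^∞`): coherent BENDING (in-plane strain linear in the height, `|ε| ~ 10⁻⁴ ≪ 1/50`) does first-order work
  `Σ_m τ_m ε_m |layer| ~ δτ · L³`, bulk order, against a quadratic cost; the own-reference window inequality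
  `E_W(Z) − E_W(flat own word) ≥ κ Σ_W D − C L²` is FALSE uniformly in `L` (gain `≈ 0.09 δτ²/K_s` per site,
  `δτ ≈ 1.05e-3`, `K_s ≈ 29.0` ⇒ `1.4e-9 … 3.8e-9` per site, tree units).
* the REPAIR that survives: the misfit budget is carried ONLY by layers near a non-hexagonal letter of the word
  (`τ_m ≡ τ_h` in hexagonal context; `Σ_m (τ_m − τ̄)² ≤ 7.5e-9 · 2K_s` per `c`-letter), and every such letter costs the
  STACKING-FAULT PRICE `≥ 4.4e-5` per site of its layer on the FLAT side (registry corner gap + alternating majorisation —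
  the landed word-side input of stmt-11779, `LayeredHull.stub_registry`, p106367): price : budget ≥ 8·10³ over all words
  tested. Hence the kernel must be stated against the RESTACKED reference (alternating word, matched scale, same heights),
  where the fault price is available, and on chart-PRISMS (equal cardinality `n K²`, layer-cake identity of
  `LayeredHull.stub_layerCake`), not against `2 E_LJ(#W)` on balls with an own-word intermediate.

Stubs (all ground-state-free except through LANDED facts):
* `stub_cleanTornFree` (K0, shared verbatim with `Sketch` / `laminar_chain`; bridge `CleanHull.cleanTornFree_of_tornFree` landed).
* `stub_ownReferenceCoercivity` (E, the kernel, XL) + `stub_faultPrice` (S, flat 1-D energetics, M) ⇒ `restackedPrismCoercivity`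
  (P1, PROVED here from E and S): for a clean set charted by `(s, Φ)` and a chart-prism of `n` layers ×
  `K × K` columns, the site energies of `Z` on the prism exceed `K² Σ_m ε_m(a′, alternating, z′)` — the layer-cake energy of the
  SAME prism of an exactly layered ALTERNATING set at some admissible `(a′, z′)` — by `κ Σ localDefect`, up to `C (nK + K²)`.
  (= own-reference coercivity with first-order misfit budget `B·#faults·K²` + fault price `c₁·#faults·K²` with `c₁ ≥ B`.)
* `stub_prismClosing` (P2, M/L): P1 + K0 ⇒ T3 (zero transversal defect at rooted clean uniformly recurrent hull elements):
  density closing on chart-prisms — (U) of `LayeredHull.stub_windowBounds` on `Φ(prism) ⊆ Z` (hull element), (L) on the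
  equal-cardinality prism of the exactly layered alternating reference (layer cake), recurrence + `CleanHull.stub_relDense` +
  `CleanHull` defect-Lipschitz; the ground-state energies CANCEL at equal cardinality. Chart from `CleanHull.stub_cleanChart`
  (K1, LANDED p161303) and K0.
Composition `CleanLimitsHaveWindows_of` = `CleanHull.cleanLimitsHaveWindows_of_exactHull` (LANDED, …Reduction.lean) ∘ P2 ∘ (P1, K0).
-/

noncomputable section

namespace Summit.AtomisticToContinuum.Crystallization.Cruxes.CleanLimitsHaveWindows.RestackedReference

open scoped BigOperators
open Filter Metric
open Literature.MathematicalPhysics.StatisticalMechanics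
open Literature.Geometry.DiscreteGeometry
open Summit.AtomisticToContinuum.Crystallization.Theorems

/-- **Stub K0 (clean torn-freeness; shared verbatim with the live line).** In an everywhere-clean set at scale `a`, every bond
has at least four common bonded neighbours. Discharged by `CleanHull.cleanTornFree_of_tornFree` once `GappedShellCensus.TornFree`
(stmt-AtomisticToContinuum-18069) is proved. [folklore] -/
theorem stub_cleanTornFree : ∀ (Y : Set (EuclideanSpace ℝ (Fin 3))) (a : ℝ), 0 < a →
    (∀ y ∈ Y, ({w ∈ Y | w ≠ y ∧ dist y w ≤ a * (1 + 1 / 50)}.ncard = 12 ∧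
        ∀ w ∈ Y, w ≠ y → a * (1 - 1 / 50) ≤ dist y w ∧
          (dist y w ≤ a * (1 + 1 / 50) ∨ a * (63 / 50) ≤ dist y w)) ∧
      ∃ T : Finset (EuclideanSpace ℝ (Fin 3)), (↑T : Set (EuclideanSpace ℝ (Fin 3))) =
          (fun w => a⁻¹ • (w - y)) '' {w ∈ Y | w ≠ y ∧ dist y w ≤ a * (1 + 1 / 50)} ∧
        (ShellCloseTo (1 / 5) T fccKissingPattern ∨ ShellCloseTo (1 / 5) T hcpKissingPattern)) →
    ∀ y ∈ Y, ∀ v ∈ Y, v ≠ y → dist y v ≤ a * (1 + 1 / 50) →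
      4 ≤ {w ∈ Y | w ≠ y ∧ w ≠ v ∧ dist y w ≤ a * (1 + 1 / 50) ∧ dist v w ≤ a * (1 + 1 / 50)}.ncard := by
  sorry

/-- **Stub E (own-reference prism coercivity with misfit budget; energy, ground-state-free, OPEN — the kernel).** For an
everywhere-clean set `Z` (scale `a ∈ [47/50, 1]`) charted by a Barlow stacking `(s, Φ)` and every chart-prism (`n` layers from `m₁`,
a `K × K` column box sheared by `haggLabel s k / 3` as in `LayeredHull.stub_layerCake`), there are admissible parameters
`a′ ∈ [47/50, 1]`, heights `z′` (increments in `[39a′/50, 17a′/20]`) such that the summed site energies of `Z` on the prism exceed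
`K²` times the layer-cake energy of the SAME `n` layers of the flat OWN-WORD reference `(a′, s, z′)`, minus the surface term
`C (nK + K²)`, minus the MISFIT BUDGET `10⁻⁶ · K² · #{m ∈ [m₁, m₁+n) : s (m+1) = s m}` (one unit per stacking fault of the window),
plus `κ Σ localDefect`. Content: exact second-order expansion about the matched own-word reference — the first-order in-plane
term is `Σ_m (τ_m − τ̄) A_m` (per-layer traction deviation × areal strain flux), NOT surface order: it is absorbed jointly with the
in-plane stretching energy, `−|τ_m − τ̄| |A_m| + ½ K_s A_m²/K² ≥ −K² (τ_m − τ̄)²/(2 K_s)`, and `Σ_m (τ_m − τ̄)²/(2K_s) ≤ 7.5e-9` per fault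
(tree units, `K_s ≈ 29.0`; kit-free numerics `num/words.py`: budget per `c`-letter `6.2e-10 … 7.5e-9` over 8 words) — so `10⁻⁶`
has a factor `> 100` in hand; then word-uniform Korn/phonon coercivity of the octet truss for the transversal part (quadratic germ =
`PhononStability`, κ₂ ≈ 0.075, kit j021372) and finite amplitude on the clean band (kit adv1). Why it might fail: finite-amplitude
coercivity far from flat (sheared / slowly rotating charted sets, John `e^{c/ε}` scales) is untested; far-fault tails must fit in `C K²`.
[folklore] -/
theorem stub_ownReferenceCoercivity : ∃ κ C : ℝ, 0 < κ ∧
    ∀ (Z : Set (EuclideanSpace ℝ (Fin 3))) (a : ℝ), 47 / 50 ≤ a → a ≤ 1 →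
    (∀ y ∈ Z, ({w ∈ Z | w ≠ y ∧ dist y w ≤ a * (1 + 1 / 50)}.ncard = 12 ∧
        ∀ w ∈ Z, w ≠ y → a * (1 - 1 / 50) ≤ dist y w ∧
          (dist y w ≤ a * (1 + 1 / 50) ∨ a * (63 / 50) ≤ dist y w)) ∧
      ∃ T : Finset (EuclideanSpace ℝ (Fin 3)), (↑T : Set (EuclideanSpace ℝ (Fin 3))) =
          (fun w => a⁻¹ • (w - y)) '' {w ∈ Z | w ≠ y ∧ dist y w ≤ a * (1 + 1 / 50)} ∧
        (ShellCloseTo (1 / 5) T fccKissingPattern ∨ ShellCloseTo (1 / 5) T hcpKissingPattern)) →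
    ∀ (s : ℤ → ℤ) (Φ : EuclideanSpace ℝ (Fin 3) → EuclideanSpace ℝ (Fin 3)), IsHaggSeq s →
      Set.BijOn Φ (barlowStacking 1 (Real.sqrt (2 / 3)) s) Z →
      (∀ p ∈ barlowStacking 1 (Real.sqrt (2 / 3)) s, ∀ q ∈ barlowStacking 1 (Real.sqrt (2 / 3)) s, p ≠ q →
        (dist p q = 1 ↔ dist (Φ p) (Φ q) ≤ a * (1 + 1 / 50))) →
    ∀ (m₁ i₀ j₀ : ℤ) (n K : ℕ), 1 ≤ n → 1 ≤ K →
      ∃ (a' : ℝ) (z' : ℤ → ℝ), 47 / 50 ≤ a' ∧ a' ≤ 1 ∧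
        (∀ m : ℤ, 39 / 50 * a' ≤ z' (m + 1) - z' m ∧ z' (m + 1) - z' m ≤ 17 / 20 * a') ∧
        (K : ℝ) ^ 2 * (∑ m ∈ Finset.Ico m₁ (m₁ + (n : ℤ)), (inLayerInteraction lennardJones a' +
            ∑' m' : ℤ, if m' = m then (0 : ℝ) else
              layerInteraction lennardJones a' (z' m' - z' m)
                (haggLabel s m' - haggLabel s m) 1))
          - C * ((n : ℝ) * (K : ℝ) + (K : ℝ) ^ 2)
          - 1 / 10 ^ 6 * ((K : ℝ) ^ 2 * (((Finset.Ico m₁ (m₁ + (n : ℤ))).filter (fun m => s (m + 1) = s m)).card : ℝ))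
          + κ * ∑ t ∈ (Finset.Ico m₁ (m₁ + (n : ℤ))) ×ˢ ((Finset.Ico i₀ (i₀ + (K : ℤ))) ×ˢ (Finset.Ico j₀ (j₀ + (K : ℤ)))),
              CleanHull.localDefect a Z (Φ (barlowPos 1 (Real.sqrt (2 / 3)) s t.1
                (t.2.1 - haggLabel s t.1 / 3) (t.2.2 - haggLabel s t.1 / 3)))
        ≤ ∑ t ∈ (Finset.Ico m₁ (m₁ + (n : ℤ))) ×ˢ ((Finset.Ico i₀ (i₀ + (K : ℤ))) ×ˢ (Finset.Ico j₀ (j₀ + (K : ℤ)))),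
              CleanHull.siteEnergy Z (Φ (barlowPos 1 (Real.sqrt (2 / 3)) s t.1
                (t.2.1 - haggLabel s t.1 / 3) (t.2.2 - haggLabel s t.1 / 3))) := by
  sorry

/-- **Stub S (stacking-fault price on the flat side; 1-D layered energetics, ground-state-free, M).** For every admissible
`(a′, s, z′)` and every window of `n` consecutive layers, the layer-cake energy of the own word exceeds that of the ALTERNATING word at
the SAME heights by at least `10⁻⁶` per stacking fault `s (m+1) = s m` in the window, up to a window-end constant `C′`. Content: the
registry corner gap and monotonicity of `barlowCoupling lennardJones a′ · 1` on `[39a′/25, ∞)` (`LayeredHull.stub_registry`, LANDED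
p106367, certified) with the alternating majorisation lemma (…PeriodicGivenLayeredMajorisation, LANDED): each fault de-aligns a
second-neighbour layer pair, price `≥ c₀`; measured per-fault prices `4.4e-5 … 8.1e-5` per site of the layer (words `cchh`, `chch`,
`c^k h^k`, isolated `c`, fcc; `num/words.py`), registry gap `−D_a(1.7a) ≈ 4.5e-5`; `10⁻⁶` leaves a factor `> 40`. Why it might fail:
densely packed faults interact (price per fault drops from `6.4e-5` isolated to `4.4e-5` paired); the landed majorisation is phrased
for the recurrence geometry of 11779 and may need a re-run for arbitrary fault patterns at extreme box heights. [folklore] -/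
theorem stub_faultPrice : ∃ C' : ℝ, ∀ (a' : ℝ), 47 / 50 ≤ a' → a' ≤ 1 → ∀ (s : ℤ → ℤ), IsHaggSeq s →
    ∀ (z' : ℤ → ℝ), (∀ m : ℤ, 39 / 50 * a' ≤ z' (m + 1) - z' m ∧ z' (m + 1) - z' m ≤ 17 / 20 * a') →
    ∀ (m₁ : ℤ) (n : ℕ),
      (∑ m ∈ Finset.Ico m₁ (m₁ + (n : ℤ)), (inLayerInteraction lennardJones a' +
          ∑' m' : ℤ, if m' = m then (0 : ℝ) else
            layerInteraction lennardJones a' (z' m' - z' m)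
              (haggLabel alternatingHagg m' - haggLabel alternatingHagg m) 1))
        + 1 / 10 ^ 6 * (((Finset.Ico m₁ (m₁ + (n : ℤ))).filter (fun m => s (m + 1) = s m)).card : ℝ) - C'
      ≤ ∑ m ∈ Finset.Ico m₁ (m₁ + (n : ℤ)), (inLayerInteraction lennardJones a' +
          ∑' m' : ℤ, if m' = m then (0 : ℝ) else
            layerInteraction lennardJones a' (z' m' - z' m) (haggLabel s m' - haggLabel s m) 1) := by
  sorry

/-- **P1 (restacked-reference prism coercivity) — DERIVED from stubs E and S.** The site energies of a clean charted set on a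
chart-prism exceed `K²` times the layer-cake energy of the equal prism of an exactly layered ALTERNATING set at admissible `(a′, z′)`,
minus `C (nK + K²)`, plus `κ Σ localDefect`: own-reference coercivity (E) pays the misfit budget `10⁻⁶` per fault, the fault price (S)
earns `10⁻⁶` per fault on the flat side; the window-end constant is absorbed into the surface term (`K² ≤ nK + K²`). [folklore] -/
theorem restackedPrismCoercivity : ∃ κ C : ℝ, 0 < κ ∧
    ∀ (Z : Set (EuclideanSpace ℝ (Fin 3))) (a : ℝ), 47 / 50 ≤ a → a ≤ 1 →
    (∀ y ∈ Z, ({w ∈ Z | w ≠ y ∧ dist y w ≤ a * (1 + 1 / 50)}.ncard = 12 ∧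
        ∀ w ∈ Z, w ≠ y → a * (1 - 1 / 50) ≤ dist y w ∧
          (dist y w ≤ a * (1 + 1 / 50) ∨ a * (63 / 50) ≤ dist y w)) ∧
      ∃ T : Finset (EuclideanSpace ℝ (Fin 3)), (↑T : Set (EuclideanSpace ℝ (Fin 3))) =
          (fun w => a⁻¹ • (w - y)) '' {w ∈ Z | w ≠ y ∧ dist y w ≤ a * (1 + 1 / 50)} ∧
        (ShellCloseTo (1 / 5) T fccKissingPattern ∨ ShellCloseTo (1 / 5) T hcpKissingPattern)) →
    ∀ (s : ℤ → ℤ) (Φ : EuclideanSpace ℝ (Fin 3) → EuclideanSpace ℝ (Fin 3)), IsHaggSeq s →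
      Set.BijOn Φ (barlowStacking 1 (Real.sqrt (2 / 3)) s) Z →
      (∀ p ∈ barlowStacking 1 (Real.sqrt (2 / 3)) s, ∀ q ∈ barlowStacking 1 (Real.sqrt (2 / 3)) s, p ≠ q →
        (dist p q = 1 ↔ dist (Φ p) (Φ q) ≤ a * (1 + 1 / 50))) →
    ∀ (m₁ i₀ j₀ : ℤ) (n K : ℕ), 1 ≤ n → 1 ≤ K →
      ∃ (a' : ℝ) (z' : ℤ → ℝ), 47 / 50 ≤ a' ∧ a' ≤ 1 ∧
        (∀ m : ℤ, 39 / 50 * a' ≤ z' (m + 1) - z' m ∧ z' (m + 1) - z' m ≤ 17 / 20 * a') ∧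
        (K : ℝ) ^ 2 * (∑ m ∈ Finset.Ico m₁ (m₁ + (n : ℤ)), (inLayerInteraction lennardJones a' +
            ∑' m' : ℤ, if m' = m then (0 : ℝ) else
              layerInteraction lennardJones a' (z' m' - z' m)
                (haggLabel alternatingHagg m' - haggLabel alternatingHagg m) 1))
          - C * ((n : ℝ) * (K : ℝ) + (K : ℝ) ^ 2)
          + κ * ∑ t ∈ (Finset.Ico m₁ (m₁ + (n : ℤ))) ×ˢ ((Finset.Ico i₀ (i₀ + (K : ℤ))) ×ˢ (Finset.Ico j₀ (j₀ + (K : ℤ)))),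
              CleanHull.localDefect a Z (Φ (barlowPos 1 (Real.sqrt (2 / 3)) s t.1
                (t.2.1 - haggLabel s t.1 / 3) (t.2.2 - haggLabel s t.1 / 3)))
        ≤ ∑ t ∈ (Finset.Ico m₁ (m₁ + (n : ℤ))) ×ˢ ((Finset.Ico i₀ (i₀ + (K : ℤ))) ×ˢ (Finset.Ico j₀ (j₀ + (K : ℤ)))),
              CleanHull.siteEnergy Z (Φ (barlowPos 1 (Real.sqrt (2 / 3)) s t.1
                (t.2.1 - haggLabel s t.1 / 3) (t.2.2 - haggLabel s t.1 / 3))) := by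
  obtain ⟨κ, C, hκ, hE⟩ := stub_ownReferenceCoercivity
  obtain ⟨C', hS⟩ := stub_faultPrice
  refine ⟨κ, C + max C' 0, hκ, ?_⟩
  intro Z a ha ha1 hclean s Φ hs hbij hbond m₁ i₀ j₀ n K hn hK
  obtain ⟨a', z', ha', ha1', hz, hineq⟩ := hE Z a ha ha1 hclean s Φ hs hbij hbond m₁ i₀ j₀ n K hn hK
  refine ⟨a', z', ha', ha1', hz, ?_⟩
  have hS' := hS a' ha' ha1' s hs z' hz m₁ n
  have hK2 : (0 : ℝ) ≤ (K : ℝ) ^ 2 := by positivity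
  have hnK : (0 : ℝ) ≤ (n : ℝ) * (K : ℝ) := by positivity
  have h3 := mul_le_mul_of_nonneg_left hS' hK2
  have h1 : (K : ℝ) ^ 2 * C' ≤ max C' 0 * ((n : ℝ) * (K : ℝ) + (K : ℝ) ^ 2) := by
    have h1a : (K : ℝ) ^ 2 * C' ≤ (K : ℝ) ^ 2 * max C' 0 := mul_le_mul_of_nonneg_left (le_max_left _ _) hK2
    have h1b : (K : ℝ) ^ 2 * max C' 0 ≤ ((n : ℝ) * (K : ℝ) + (K : ℝ) ^ 2) * max C' 0 :=
      mul_le_mul_of_nonneg_right (by linarith) (le_max_right _ _)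
    linarith [h1a, h1b]
  nlinarith [h3, h1, hineq, hK2, hnK, mul_nonneg hK2 (le_max_right C' 0)]

/-- **Stub P2 (density closing on chart-prisms; M/L).** From P1 and K0: a rooted, everywhere-clean, rooted-uniformly recurrent
hull element `Z` of a Lennard-Jones ground-state sequence has identically vanishing transversal defect (T3, the hypothesis of the
LANDED `CleanHull.cleanLimitsHaveWindows_of_exactHull`). Mechanism: `Z` is torn-free (K0) hence charted
(`CleanHull.stub_cleanChart`, landed); if `localDefect a Z p₀ > 0` then by recurrence, relative denseness and the defect-Lipschitz
lemma every large chart-prism carries defect mass `≥ c n K²`; P1 bounds the prism energy from BELOW by the layer-cake energy of the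
equal-cardinality prism of an exactly layered alternating set plus `κ c n K² − C(nK + K²)`, which by the landed (L)
(`LayeredHull.stub_windowBounds`, any separated set) is `≥ 2 E_LJ(nK²) − C′(nK + K²) + κ c n K²`; the landed (U) bounds it from ABOVE
by `2 E_LJ(nK²) + C″ ∂(Φ(prism))` with `∂ ≤ C (nK + K²)` for charted clean sets (bond-Lipschitz chart; large-scale injectivity à la
John) — the ground-state energies cancel and `n = K → ∞` is a contradiction. Why it might fail: the boundary functional
`Σ (1 + infDist)⁻³` of a chart-prism needs a quantitative non-self-approach of globally charted clean sets. [folklore] -/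
theorem stub_prismClosing
    (hP1 : ∃ κ C : ℝ, 0 < κ ∧
      ∀ (Z : Set (EuclideanSpace ℝ (Fin 3))) (a : ℝ), 47 / 50 ≤ a → a ≤ 1 →
      (∀ y ∈ Z, ({w ∈ Z | w ≠ y ∧ dist y w ≤ a * (1 + 1 / 50)}.ncard = 12 ∧
          ∀ w ∈ Z, w ≠ y → a * (1 - 1 / 50) ≤ dist y w ∧
            (dist y w ≤ a * (1 + 1 / 50) ∨ a * (63 / 50) ≤ dist y w)) ∧
        ∃ T : Finset (EuclideanSpace ℝ (Fin 3)), (↑T : Set (EuclideanSpace ℝ (Fin 3))) =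
            (fun w => a⁻¹ • (w - y)) '' {w ∈ Z | w ≠ y ∧ dist y w ≤ a * (1 + 1 / 50)} ∧
          (ShellCloseTo (1 / 5) T fccKissingPattern ∨ ShellCloseTo (1 / 5) T hcpKissingPattern)) →
      ∀ (s : ℤ → ℤ) (Φ : EuclideanSpace ℝ (Fin 3) → EuclideanSpace ℝ (Fin 3)), IsHaggSeq s →
        Set.BijOn Φ (barlowStacking 1 (Real.sqrt (2 / 3)) s) Z →
        (∀ p ∈ barlowStacking 1 (Real.sqrt (2 / 3)) s, ∀ q ∈ barlowStacking 1 (Real.sqrt (2 / 3)) s, p ≠ q →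
          (dist p q = 1 ↔ dist (Φ p) (Φ q) ≤ a * (1 + 1 / 50))) →
      ∀ (m₁ i₀ j₀ : ℤ) (n K : ℕ), 1 ≤ n → 1 ≤ K →
        ∃ (a' : ℝ) (z' : ℤ → ℝ), 47 / 50 ≤ a' ∧ a' ≤ 1 ∧
          (∀ m : ℤ, 39 / 50 * a' ≤ z' (m + 1) - z' m ∧ z' (m + 1) - z' m ≤ 17 / 20 * a') ∧
          (K : ℝ) ^ 2 * (∑ m ∈ Finset.Ico m₁ (m₁ + (n : ℤ)), (inLayerInteraction lennardJones a' +
              ∑' m' : ℤ, if m' = m then (0 : ℝ) else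
                layerInteraction lennardJones a' (z' m' - z' m)
                  (haggLabel alternatingHagg m' - haggLabel alternatingHagg m) 1))
            - C * ((n : ℝ) * (K : ℝ) + (K : ℝ) ^ 2)
            + κ * ∑ t ∈ (Finset.Ico m₁ (m₁ + (n : ℤ))) ×ˢ ((Finset.Ico i₀ (i₀ + (K : ℤ))) ×ˢ (Finset.Ico j₀ (j₀ + (K : ℤ)))),
                CleanHull.localDefect a Z (Φ (barlowPos 1 (Real.sqrt (2 / 3)) s t.1
                  (t.2.1 - haggLabel s t.1 / 3) (t.2.2 - haggLabel s t.1 / 3)))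
          ≤ ∑ t ∈ (Finset.Ico m₁ (m₁ + (n : ℤ))) ×ˢ ((Finset.Ico i₀ (i₀ + (K : ℤ))) ×ˢ (Finset.Ico j₀ (j₀ + (K : ℤ)))),
                CleanHull.siteEnergy Z (Φ (barlowPos 1 (Real.sqrt (2 / 3)) s t.1
                  (t.2.1 - haggLabel s t.1 / 3) (t.2.2 - haggLabel s t.1 / 3))))
    (hK0 : ∀ (Y : Set (EuclideanSpace ℝ (Fin 3))) (a : ℝ), 0 < a →
      (∀ y ∈ Y, ({w ∈ Y | w ≠ y ∧ dist y w ≤ a * (1 + 1 / 50)}.ncard = 12 ∧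
          ∀ w ∈ Y, w ≠ y → a * (1 - 1 / 50) ≤ dist y w ∧
            (dist y w ≤ a * (1 + 1 / 50) ∨ a * (63 / 50) ≤ dist y w)) ∧
        ∃ T : Finset (EuclideanSpace ℝ (Fin 3)), (↑T : Set (EuclideanSpace ℝ (Fin 3))) =
            (fun w => a⁻¹ • (w - y)) '' {w ∈ Y | w ≠ y ∧ dist y w ≤ a * (1 + 1 / 50)} ∧
          (ShellCloseTo (1 / 5) T fccKissingPattern ∨ ShellCloseTo (1 / 5) T hcpKissingPattern)) →
      ∀ y ∈ Y, ∀ v ∈ Y, v ≠ y → dist y v ≤ a * (1 + 1 / 50) →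
        4 ≤ {w ∈ Y | w ≠ y ∧ w ≠ v ∧ dist y w ≤ a * (1 + 1 / 50) ∧ dist v w ≤ a * (1 + 1 / 50)}.ncard) :
    ∀ x : (N : ℕ) → (Fin N → EuclideanSpace ℝ (Fin 3)), (∀ N, IsGroundState lennardJones (x N)) →
      ∀ (Z : Set (EuclideanSpace ℝ (Fin 3))) (a : ℝ), 47 / 50 ≤ a → a ≤ 1 → (0 : EuclideanSpace ℝ (Fin 3)) ∈ Z →
      (∀ R ε : ℝ, 0 < ε → ∃ᶠ N in Filter.atTop, ∃ t : EuclideanSpace ℝ (Fin 3), (∀ p ∈ Z, ‖p‖ ≤ R →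
          ∃ i : Fin N, dist (x N i + t) p ≤ ε) ∧ (∀ i : Fin N, ‖x N i + t‖ ≤ R → ∃ p ∈ Z, dist (x N i + t) p ≤ ε)) →
      (∀ y ∈ Z, ({w ∈ Z | w ≠ y ∧ dist y w ≤ a * (1 + 1 / 50)}.ncard = 12 ∧ ∀ w ∈ Z, w ≠ y →
          a * (1 - 1 / 50) ≤ dist y w ∧ (dist y w ≤ a * (1 + 1 / 50) ∨ a * (63 / 50) ≤ dist y w)) ∧
          (∃ T : Finset (EuclideanSpace ℝ (Fin 3)),
          (↑T : Set (EuclideanSpace ℝ (Fin 3))) = (fun w => a⁻¹ • (w - y)) ''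
              {w ∈ Z | w ≠ y ∧ dist y w ≤ a * (1 + 1 / 50)} ∧
              (ShellCloseTo (1 / 5) T fccKissingPattern ∨ ShellCloseTo (1 / 5) T hcpKissingPattern))) →
      (∀ R ε : ℝ, 0 < ε → ∃ G : ℝ, ∀ w ∈ Z, ∃ g ∈ Z, dist g w ≤ G ∧ BallMatch ε R 0 ((fun p => p - g) '' Z) Z) →
      ∀ p ∈ Z, CleanHull.localDefect a Z p = 0 := by
  sorry

/-- **The crux from the stubs.** `GappedShellCensus.CleanLimitsHaveWindows` (stmt-AtomisticToContinuum-15932): T3 from P1 + K0 by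
the prism closing (P2), then the LANDED `CleanHull.cleanLimitsHaveWindows_of_exactHull` (soft half, defect-free rigidity, box pinning,
and the PROVED `LayeredHull.PeriodicGivenLayered_proof`, stmt-11779). [folklore] -/
theorem CleanLimitsHaveWindows_of :
    Summit.AtomisticToContinuum.Crystallization.Theses.GappedShellCensus.CleanLimitsHaveWindows :=
  CleanHull.cleanLimitsHaveWindows_of_exactHull (stub_prismClosing restackedPrismCoercivity stub_cleanTornFree)

end Summit.AtomisticToContinuum.Crystallization.Cruxes.CleanLimitsHaveWindows.RestackedReference

end
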